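import Literature.IUT.HodgeTheaters.StableCurveTemperedDataOfSpecialFibreCor25
import Literature.IUT.HodgeTheaters.TemperedCoveringsProofs
import Literature.AnabelianGeometry.SemiGraphs.TemperedOriginGenuineNonVacuity
import Literature.AnabelianGeometry.SemiGraphs.SpecialFibreTowerOfCharLevels
import HarnessLib

/-!
# [IUTchI] Prop. 2.4 (i)(ii)(iii) (with Prop. 2.1, Rmk. 2.2.2, Cor. 2.5) AS TYPED hold at every 𝔛-datum with
# `Π^tp_X ↪ Π̂_X` onto — in particular at the genuine constructor `ofSpecialFibre X d S …` whenever `Π^temp_{X_K}`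
# is compact, and at a kernel inhabitant of its input package with genuine arithmetic side

Mochizuki, *Inter-universal Teichmüller theory I*, kurims manuscript (May 2020), §2, Proposition 2.4 p. 50
([IUTchI] Prop 2.4 p.50) [claim: Mochizuki2012, status: disputed] (D-0012 claim key; nothing of the series is
asserted here): "(i) Let `Λ ⊆ Δ^tp_X` be a nontrivial pro-`Σ` compact subgroup, `γ ∈ Π̂_X` an element such that
`γ·Λ·γ⁻¹ ⊆ Δ^tp_X`. Then `γ ∈ Π^tp_X`. (ii) … (iii) `Δ^tp_X ⊆ Δ̂_X` (respectively, `Π^tp_X ⊆ Π̂_X`) is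
commensurably terminal", over Mochizuki, *Semi-graphs of anabelioids*, Publ. RIMS **42** (2006), Ex. 3.10
pp. 44–45 and §6 p. 69 [cite: MochizukiSemiAnbd2006, Ex 3.10 pp.44-45].

PROOF-ONLY companion (abc-iut cell, block F fact-proving wave, seat abc-iut-f-193, FACT-LIST rows F-2599
`Prop24i` · F-2600 `Prop24ii` · F-2601 `Prop24iii` — parametrised schemata whose universal closures are REFUTED
in the tree, `FactListClosureRefutations.exists_not_prop24`; admissible "at named instances only", R5).  The
named instance the cone consumers cite is the genuine 𝔛-datum `StableCurveTemperedData.ofSpecialFibre X d S h36 …`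
(abc-iut-L5-t11; consumers `…OfSpecialFibreCor25`, `LabelClassesOfCuspsCor24iOfSpecialFibre`).  What is proved:

* `prop24i_of_ιX_surjective`, `prop24ii_of_ιX_surjective`, `prop24iii_of_ιX_surjective` — for ANY
  `D : StableCurveTemperedData`, if the natural inclusion `ιX : Π^tp_X → Π̂_X` is onto then the three typed
  predicates hold ((i)/(ii): the conclusion `γ ∈ Π^tp_X` is automatic; (iii): `Δ^tp_X ↪ Δ̂_X` is then onto as
  well (`ιΔ_surjective_of_ιX_surjective`), so both commensurators are commensurators of the full group, and the
  `Π`-half is abc-iut-L5-t11's `prop24iii_of_delta`);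
* over the [SemiAnbd] §6 interface `TemperedCurve p`: if `Π^temp_{X_K}` is compact, `Π^temp_{X_K} ↪ Π_{X_K}` is
  onto (abc-iut-w6-d055's `TemperedCurve.toHat_surjective_of_compactSpace`, BY NAME); hence
  `prop24i_ofSpecialFibre_of_compactSpace`, `prop24ii_…`, `prop24iii_…`: the consumers' instance forms
  `(ofSpecialFibre X d S h36 Σ Σ̂ … ).Prop24i/ii/iii` hold for EVERY parameter choice at every such `X`; with a
  closed point and a cusp also Cor. 2.5 (`cor25_ofSpecialFibre_of_compactSpace`, BY NAME from abc-iut-L5-t11's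
  `cor25_ofSpecialFibre`); and at the GRAPH level (`Π^tp_𝔾 ↪ Π̂_𝔾` of the special-fibre chart, compact with
  `Π^temp`): Prop. 2.1 and Rmk. 2.2.2 AS TYPED (`graph_prop21_ofSpecialFibre_of_compactSpace`,
  `graph_temperedNormallyTerminal_ofSpecialFibre_of_compactSpace`; generic forms
  `TemperedGraphGroupData.prop21_of_ι_surjective`, `…temperedNormallyTerminal_of_ι_surjective`,
  `…ofChart_ι_surjective_of_compactSpace`);
* `exists_ofSpecialFibre_input_prop24` — NON-VACUITY of the whole input package of the genuine constructor
  with GENUINE arithmetic side: a `TemperedCurve p` with `K = ℚ_p`, augmentation ONTO `G_{ℚ_p}`, nonabelian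
  slim `Δ^temp`, compact `Π^temp` (abc-iut-w5-d040's `exists_temperedCurve_groupLevelData_genuine`), carrying
  `GroupLevelData d`, special-fibre data `S` over `X.toTemperedArithmeticGroup d` (the one-vertex semi-graph
  `B(Δ^temp)` of abc-iut-L3-t2, chart `π₁^temp = Δ^temp`, admissible quotient the identity — the pattern of
  `SpecialFibreTower.PiData.nonempty_of_charLevels`) and `h36`, at which, for all parameters `Σ ⊆ Σ̂`, `p ∉ Σ`,
  `Π_ℍ`, `cuspMeetsH`: graph-level Prop. 2.1 ∧ Rmk. 2.2.2, Prop. 2.4 (i) ∧ (ii) ∧ (iii), Cor. 2.5 (both clauses)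
  AS TYPED.

HONEST LIMITS.  André's `Π^temp_{X_K}` of a hyperbolic curve is never compact: at compact `Π^temp` "tempered =
profinite" and Prop. 2.4 is CONTENT-FREE (this is consistency evidence for the typed instance forms and the
constructor's input package — the FACT-LIST reading "instance form MODEL-WITNESSED at the genuine constructor";
the non-vacuous behaviour of (i)/(ii) and the failure of (iii) at a NON-compact datum are abc-iut-f-193 g0's
`TemperedCoveringsDihedralModel`).  The capstones with content — `prop24i_ofSpecialFibre_of_tower`,
`prop24ii_ofPiData`, `prop24iii_ofSpecialFibre` (abc-iut-L5-t11, abc-iut-w4-d063) — and their analytic binders are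
untouched.  No definition, no new `Prop` fact; nothing here bears on [IUTchIII] Cor. 3.12; no curve is asserted
to realise the inhabitant.
-/

noncomputable section

namespace Literature.IUT.HodgeTheaters

open Topology
open scoped Pointwise
open Literature.AnabelianGeometry.AbsoluteAnabelian (IsCommensurablyTerminal)
open Literature.AlgebraicGeometry.Frobenioids (IsSlimGroup)
open Literature.AnabelianGeometry.SemiGraphs Literature.AnabelianGeometry.SemiGraphs.ProfiniteSemiGraph

universe u v

/-! ### Two group-theoretic trivialities -/

/-- Conjugation fixes the full subgroup. [folklore] -/
private theorem conjAct_smul_top_eq {G : Type u} [Group G] (g : G) :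
    ConjAct.toConjAct g • (⊤ : Subgroup G) = ⊤ :=
  eq_top_iff.mpr fun x _ => by
    rw [Subgroup.mem_pointwise_smul_iff_inv_smul_mem]
    exact Subgroup.mem_top _

/-- The full subgroup is commensurably terminal: `C_G(G) = G`. [cite: MochizukiAbsAnab2004, Def 0.1 (iii) p.4] -/
private theorem isCommensurablyTerminal_top_aux {G : Type u} [Group G] :
    IsCommensurablyTerminal (⊤ : Subgroup G) :=
  ⟨eq_top_iff.mpr fun g _ => by
    rw [Subgroup.Commensurable.commensurator_mem_iff, conjAct_smul_top_eq g]⟩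

/-! ### Profinite completions of compact groups are onto -/

/-- A profinite completion map `ι : F → F̂` (in the sense of `IsProfiniteCompletion`: `F̂` profinite, `ι` with
dense image) out of a COMPACT group is onto: its image is compact, hence closed, and dense.
[cite: MochizukiSemiAnbd2006, §6 p.69] -/
theorem surjective_of_isProfiniteCompletion_of_compactSpace {F : Type u} {Fhat : Type v} [Group F]
    [TopologicalSpace F] [Group Fhat] [TopologicalSpace Fhat] [CompactSpace F] {ι : F →ₜ* Fhat}
    (h : IsProfiniteCompletion ι) : Function.Surjective ι := by
  haveI : T2Space Fhat := h.t2Space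
  have hcl : IsClosed (Set.range ι) := (isCompact_range ι.continuous).isClosed
  rw [← Set.range_eq_univ, ← hcl.closure_eq]
  exact h.denseRange.closure_eq

namespace TemperedGraphGroupData

/-! ### 𝔾-data with `Π^tp_𝔾 ↪ Π̂_𝔾` onto: Prop. 2.1 and Rmk. 2.2.2 AS TYPED -/

section Surjective

variable (G : TemperedGraphGroupData.{u})

/-- **[IUTchI] Prop. 2.1 AS TYPED holds at every 𝔾-datum with `Π^tp_𝔾 ↪ Π̂_𝔾` onto**: the conclusion
`γ ∈ Π^tp_𝔾` holds for every `γ ∈ Π̂_𝔾` outright. ([IUTchI] Prop 2.1 p.45) [claim: Mochizuki2012, status: disputed] -/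
theorem prop21_of_ι_surjective (h : Function.Surjective G.ι) : G.ProfiniteConjugatesOfCompactSubgroups :=
  ⟨fun _ _ _ γ _ => MonoidHom.mem_range.mpr (h γ)⟩

/-- **[IUTchI] Rmk. 2.2.2 AS TYPED holds at every 𝔾-datum with `Π^tp_𝔾 ↪ Π̂_𝔾` onto** (for any `Σ̂`): the
full subgroup is its own normaliser. ([IUTchI] Rmk 2.2.2 p.46) [claim: Mochizuki2012, status: disputed] -/
theorem temperedNormallyTerminal_of_ι_surjective (h : Function.Surjective G.ι) : G.TemperedNormallyTerminal :=
  ⟨fun _ => by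
    rw [MonoidHom.range_eq_top.mpr h]
    exact isCommensurablyTerminal_top_aux.isNormallyTerminal⟩

end Surjective

/-- **The 𝔾-datum `ofChart 𝒢 h36 c …` of a chart with COMPACT group `c.G` has `Π^tp_𝔾 ↪ Π̂_𝔾` onto** (its `ι`
is a profinite completion map, `ofChart_isProfiniteCompletion`). ([IUTchI] §2 pp.44-45) [claim: Mochizuki2012, status: disputed] -/
theorem ofChart_ι_surjective_of_compactSpace (𝒢 : ProfiniteSemiGraph.{u}) (h36 : 𝒢.Prop36Hypotheses)
    (c : TemperedPiChart 𝒢) [CompactSpace c.G]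
    (Sigma SigmaHat : Set ℕ) (hsub : Sigma ⊆ SigmaHat) (hne : Sigma.Nonempty)
    (hprime : ∀ p ∈ SigmaHat, p.Prime) (TpH : Subgroup c.G)
    (HatH : Subgroup (exists_completion_of_prop36 𝒢 h36 c).choose)
    (hle : TpH.map (exists_completion_of_prop36 𝒢 h36 c).choose_spec.choose.toMonoidHom ≤ HatH) :
    Function.Surjective (ofChart 𝒢 h36 c Sigma SigmaHat hsub hne hprime TpH HatH hle).ι :=
  @surjective_of_isProfiniteCompletion_of_compactSpace _ _ _ _ _ _ ‹CompactSpace c.G› _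
    (ofChart_isProfiniteCompletion 𝒢 h36 c Sigma SigmaHat hsub hne hprime TpH HatH hle)

end TemperedGraphGroupData

namespace StableCurveTemperedData

/-! ### Any 𝔛-datum with `Π^tp_X ↪ Π̂_X` onto -/

section Surjective

variable (D : StableCurveTemperedData.{u})

/-- If `Π^tp_X ↪ Π̂_X` is onto, so is `Δ^tp_X ↪ Δ̂_X` (an element of `Ker(Π̂_X ↠ G_k)` is `ι(t)` with
`t ∈ Ker(Π^tp_X ↠ G_k)` by the compatibility of the two surjections to `G_k`). ([IUTchI] §2 p.47) [claim: Mochizuki2012, status: disputed] -/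
theorem ιΔ_surjective_of_ιX_surjective (h : Function.Surjective D.ιX) : Function.Surjective D.ιΔ := by
  intro y
  obtain ⟨x, hx⟩ := h (y : D.PiHat)
  have hxΔ : x ∈ D.DeltaTp := by
    rw [MonoidHom.mem_ker, ← D.prHat_ιX, hx]
    exact (MonoidHom.mem_ker).mp y.2
  exact ⟨⟨x, hxΔ⟩, Subtype.ext hx⟩

/-- If `Π^tp_X ↪ Π̂_X` is onto, `Δ^tp_X ↪ Δ̂_X` has full range. ([IUTchI] §2 p.47) [claim: Mochizuki2012, status: disputed] -/
theorem ιΔ_range_eq_top_of_ιX_surjective (h : Function.Surjective D.ιX) : D.ιΔ.range = ⊤ :=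
  MonoidHom.range_eq_top.mpr (D.ιΔ_surjective_of_ιX_surjective h)

/-- **[IUTchI] Prop. 2.4 (i) AS TYPED holds at every datum with `Π^tp_X ↪ Π̂_X` onto**: the conclusion
`γ ∈ Π^tp_X` holds for every `γ ∈ Π̂_X` outright. ([IUTchI] Prop 2.4(i) p.50) [claim: Mochizuki2012, status: disputed] -/
theorem prop24i_of_ιX_surjective (h : Function.Surjective D.ιX) : D.Prop24i :=
  ⟨fun _ _ _ _ γ _ => MonoidHom.mem_range.mpr (h γ)⟩

/-- **[IUTchI] Prop. 2.4 (ii) AS TYPED holds at every datum with `Π^tp_X ↪ Π̂_X` onto** (for any `Σ̂`).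
([IUTchI] Prop 2.4(ii) p.50) [claim: Mochizuki2012, status: disputed] -/
theorem prop24ii_of_ιX_surjective (h : Function.Surjective D.ιX) : D.Prop24ii :=
  ⟨fun _ _ _ _ _ γ _ => MonoidHom.mem_range.mpr (h γ)⟩

/-- **[IUTchI] Prop. 2.4 (iii) AS TYPED holds at every datum with `Π^tp_X ↪ Π̂_X` onto**: then
`Δ^tp_X = Δ̂_X` and `Π^tp_X = Π̂_X` as subgroups, and a group is commensurably terminal in itself (the
`Π`-half via abc-iut-L5-t11's `prop24iii_of_delta`). ([IUTchI] Prop 2.4(iii) p.50) [claim: Mochizuki2012, status: disputed] -/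
theorem prop24iii_of_ιX_surjective (h : Function.Surjective D.ιX) : D.Prop24iii :=
  D.prop24iii_of_delta (by
    rw [D.ιΔ_range_eq_top_of_ιX_surjective h]
    exact isCommensurablyTerminal_top_aux)

end Surjective

/-! ### The genuine constructor `ofSpecialFibre` at compact `Π^temp_{X_K}` -/

namespace OfSpecialFibre

variable {p : ℕ} [Fact p.Prime] (X : TemperedCurve p)

variable (d : X.GroupLevelData) (S : SpecialFibreData (X.toTemperedArithmeticGroup d))
  (h36 : S.Gc.Prop36Hypotheses)
  (Sigma SigmaHat : Set ℕ) (hsub : Sigma ⊆ SigmaHat) (hne : Sigma.Nonempty)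
  (hprime : ∀ q ∈ SigmaHat, q.Prime) (hp : p ∉ Sigma)
  (TpH : Subgroup S.chart.G)
  (HatH : Subgroup (TemperedGraphGroupData.exists_completion_of_prop36 S.Gc h36 S.chart).choose)
  (hle : TpH.map (TemperedGraphGroupData.exists_completion_of_prop36 S.Gc h36
    S.chart).choose_spec.choose.toMonoidHom ≤ HatH)
  (cuspMeetsH : {x : X.Pt // X.IsCusp x} → Prop)

/-- **[IUTchI] Prop. 2.4 (i) AS TYPED at the genuine 𝔛-datum `ofSpecialFibre X d S …`, for compact
`Π^temp_{X_K}`** — every parameter choice. ([IUTchI] Prop 2.4(i) p.50) [claim: Mochizuki2012, status: disputed] -/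
theorem prop24i_ofSpecialFibre_of_compactSpace [CompactSpace X.PiTemp] :
    (ofSpecialFibre X d S h36 Sigma SigmaHat hsub hne hprime hp TpH HatH hle cuspMeetsH).Prop24i :=
  prop24i_of_ιX_surjective _ (X.toHat_surjective_of_compactSpace)

/-- **[IUTchI] Prop. 2.4 (ii) AS TYPED at the genuine 𝔛-datum `ofSpecialFibre X d S …`, for compact
`Π^temp_{X_K}`.** ([IUTchI] Prop 2.4(ii) p.50) [claim: Mochizuki2012, status: disputed] -/
theorem prop24ii_ofSpecialFibre_of_compactSpace [CompactSpace X.PiTemp] :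
    (ofSpecialFibre X d S h36 Sigma SigmaHat hsub hne hprime hp TpH HatH hle cuspMeetsH).Prop24ii :=
  prop24ii_of_ιX_surjective _ (X.toHat_surjective_of_compactSpace)

/-- **[IUTchI] Prop. 2.4 (iii) AS TYPED at the genuine 𝔛-datum `ofSpecialFibre X d S …`, for compact
`Π^temp_{X_K}`.** ([IUTchI] Prop 2.4(iii) p.50) [claim: Mochizuki2012, status: disputed] -/
theorem prop24iii_ofSpecialFibre_of_compactSpace [CompactSpace X.PiTemp] :
    (ofSpecialFibre X d S h36 Sigma SigmaHat hsub hne hprime hp TpH HatH hle cuspMeetsH).Prop24iii :=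
  prop24iii_of_ιX_surjective _ (X.toHat_surjective_of_compactSpace)

/-- **[IUTchI] Cor. 2.5 (both clauses) AS TYPED at the genuine 𝔛-datum, for compact `Π^temp_{X_K}` with a closed
point and a cusp** — BY NAME from abc-iut-L5-t11's `cor25_ofSpecialFibre` (Cor. 2.5 ⇐ Prop. 2.4 (i), (ii) at the
genuine datum) and the two instance forms above. ([IUTchI] Cor 2.5 p.51) [claim: Mochizuki2012, status: disputed] -/
theorem cor25_ofSpecialFibre_of_compactSpace [CompactSpace X.PiTemp] [Nonempty X.Pt]
    [Nonempty {x : X.Pt // X.IsCusp x}] :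
    (ofSpecialFibre X d S h36 Sigma SigmaHat hsub hne hprime hp TpH HatH hle cuspMeetsH).Cor25Decomposition ∧
      (ofSpecialFibre X d S h36 Sigma SigmaHat hsub hne hprime hp TpH HatH hle cuspMeetsH).Cor25Inertia :=
  cor25_ofSpecialFibre X d S h36 Sigma SigmaHat hsub hne hprime hp TpH HatH hle cuspMeetsH
    (prop24i_ofSpecialFibre_of_compactSpace X d S h36 Sigma SigmaHat hsub hne hprime hp TpH HatH hle cuspMeetsH)
    (prop24ii_ofSpecialFibre_of_compactSpace X d S h36 Sigma SigmaHat hsub hne hprime hp TpH HatH hle cuspMeetsH)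

/-! ### The graph level of the genuine constructor at compact `Π^temp_{X_K}` -/

/-- For compact `Π^temp_{X_K}` the chart group `π₁^temp(G^c)` of any special-fibre datum is compact: it is the
continuous image of the closed subgroup `Δ = Ker(aug)` under the admissible surjection.
[cite: MochizukiSemiAnbd2006, Ex 3.10 p.45] -/
theorem compactSpace_chart_of_compactSpace [CompactSpace X.PiTemp] : CompactSpace S.chart.G := by
  have hδ : (X.toTemperedArithmeticGroup d).delta = X.DeltaTemp := X.toTemperedArithmeticGroup_delta d
  have hcl : IsClosed ((X.toTemperedArithmeticGroup d).delta : Set (X.toTemperedArithmeticGroup d).Pi) := by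
    rw [hδ]
    exact X.isClosed_deltaTemp
  haveI : CompactSpace (X.toTemperedArithmeticGroup d).Pi := ‹CompactSpace X.PiTemp›
  haveI : CompactSpace (X.toTemperedArithmeticGroup d).delta := isCompact_iff_compactSpace.mp hcl.isCompact
  refine ⟨?_⟩
  rw [← Set.range_eq_univ.mpr S.admissible_surjective]
  exact isCompact_range S.admissible.continuous

/-- **At compact `Π^temp_{X_K}` the graph level `Π^tp_𝔾 ↪ Π̂_𝔾` of the genuine 𝔛-datum is onto** (the 𝔾-datum is
`ofChart` of the special-fibre chart, whose group is compact). ([IUTchI] §2 pp.44-47) [claim: Mochizuki2012, status: disputed] -/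
theorem graph_ι_surjective_of_compactSpace [CompactSpace X.PiTemp] :
    Function.Surjective (ofSpecialFibre X d S h36 Sigma SigmaHat hsub hne hprime hp TpH HatH hle cuspMeetsH).graph.ι := by
  haveI := compactSpace_chart_of_compactSpace X d S
  exact TemperedGraphGroupData.ofChart_ι_surjective_of_compactSpace S.Gc h36 S.chart Sigma SigmaHat hsub hne
    hprime TpH HatH hle

/-- **[IUTchI] Prop. 2.1 AS TYPED at the graph level of the genuine 𝔛-datum, for compact `Π^temp_{X_K}`.**
([IUTchI] Prop 2.1 p.45) [claim: Mochizuki2012, status: disputed] -/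
theorem graph_prop21_ofSpecialFibre_of_compactSpace [CompactSpace X.PiTemp] :
    (ofSpecialFibre X d S h36 Sigma SigmaHat hsub hne hprime hp TpH HatH hle cuspMeetsH).graph.ProfiniteConjugatesOfCompactSubgroups :=
  TemperedGraphGroupData.prop21_of_ι_surjective _ (graph_ι_surjective_of_compactSpace X d S h36 Sigma SigmaHat hsub hne hprime hp TpH HatH hle cuspMeetsH)

/-- **[IUTchI] Rmk. 2.2.2 AS TYPED at the graph level of the genuine 𝔛-datum, for compact `Π^temp_{X_K}`.**
([IUTchI] Rmk 2.2.2 p.46) [claim: Mochizuki2012, status: disputed] -/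
theorem graph_temperedNormallyTerminal_ofSpecialFibre_of_compactSpace [CompactSpace X.PiTemp] :
    (ofSpecialFibre X d S h36 Sigma SigmaHat hsub hne hprime hp TpH HatH hle cuspMeetsH).graph.TemperedNormallyTerminal :=
  TemperedGraphGroupData.temperedNormallyTerminal_of_ι_surjective _ (graph_ι_surjective_of_compactSpace X d S h36 Sigma SigmaHat hsub hne hprime hp TpH HatH hle cuspMeetsH)

end OfSpecialFibre

/-! ### Non-vacuity: the input package of `ofSpecialFibre` with genuine arithmetic side, and Prop. 2.4 there -/

open OfSpecialFibre

/-- **The input package `(X, d, S, h36)` of the genuine §2 constructor `ofSpecialFibre` is INHABITED with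
genuine arithmetic side, and [IUTchI] Prop. 2.4 (i)(ii)(iii) AS TYPED hold at the resulting 𝔛-datum for every
parameter choice.**  The §6 datum is abc-iut-w5-d040's (`K = ℚ_p`, `aug` onto `G_{ℚ_p}`, `Π^temp` compact and
slim, `Δ^temp` nonabelian slim); the special-fibre data is the one-vertex semi-graph of anabelioids `B(Δ^temp)`
(abc-iut-L3-t2's `OneVertex.graph` / `OneVertex.chart`, hypotheses of Thm. 3.7 from slimness and a level family,
which every infinite second-countable profinite group carries) with admissible quotient the identity
`Δ = Δ^temp` (kernel `1`).  Consistency evidence only: compact `Π^temp`, one-vertex fibre, no origin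
certificate; not the special fibre of a curve. [cite: MochizukiSemiAnbd2006, Ex 3.10 pp.44-45] -/
theorem exists_ofSpecialFibre_input_prop24 (p : ℕ) [Fact p.Prime] :
    ∃ X : TemperedCurve p, X.K = ⊥ ∧ Function.Surjective X.aug ∧ CompactSpace X.PiTemp ∧
      (∃ g ∈ X.DeltaTemp, ∃ h ∈ X.DeltaTemp, g * h ≠ h * g) ∧ (∃ x : X.Pt, X.IsCusp x) ∧
      ∃ (d : X.GroupLevelData) (S : SpecialFibreData (X.toTemperedArithmeticGroup d))
        (h36 : S.Gc.Prop36Hypotheses),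
        S.admissible.toMonoidHom.ker = ⊥ ∧
        ∀ (Sigma SigmaHat : Set ℕ) (hsub : Sigma ⊆ SigmaHat) (hne : Sigma.Nonempty)
          (hprime : ∀ q ∈ SigmaHat, q.Prime) (hp : p ∉ Sigma) (TpH : Subgroup S.chart.G)
          (HatH : Subgroup (TemperedGraphGroupData.exists_completion_of_prop36 S.Gc h36 S.chart).choose)
          (hle : TpH.map (TemperedGraphGroupData.exists_completion_of_prop36 S.Gc h36
            S.chart).choose_spec.choose.toMonoidHom ≤ HatH)
          (cuspMeetsH : {x : X.Pt // X.IsCusp x} → Prop),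
          (ofSpecialFibre X d S h36 Sigma SigmaHat hsub hne hprime hp TpH HatH hle
              cuspMeetsH).graph.ProfiniteConjugatesOfCompactSubgroups ∧
          (ofSpecialFibre X d S h36 Sigma SigmaHat hsub hne hprime hp TpH HatH hle
              cuspMeetsH).graph.TemperedNormallyTerminal ∧
          (ofSpecialFibre X d S h36 Sigma SigmaHat hsub hne hprime hp TpH HatH hle cuspMeetsH).Prop24i ∧
          (ofSpecialFibre X d S h36 Sigma SigmaHat hsub hne hprime hp TpH HatH hle cuspMeetsH).Prop24ii ∧
          (ofSpecialFibre X d S h36 Sigma SigmaHat hsub hne hprime hp TpH HatH hle cuspMeetsH).Prop24iii ∧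
          (ofSpecialFibre X d S h36 Sigma SigmaHat hsub hne hprime hp TpH HatH hle cuspMeetsH).Cor25Decomposition ∧
          (ofSpecialFibre X d S h36 Sigma SigmaHat hsub hne hprime hp TpH HatH hle cuspMeetsH).Cor25Inertia := by
  classical
  obtain ⟨X, hK, haug, ⟨d⟩, hcusp, hnc, -, hslimΔ, hcpt, -⟩ := exists_temperedCurve_groupLevelData_genuine p
  haveI := hcpt
  obtain ⟨x₀, hx₀⟩ := hcusp
  haveI : Nonempty X.Pt := ⟨x₀⟩
  haveI : Nonempty {x : X.Pt // X.IsCusp x} := ⟨⟨x₀, hx₀⟩⟩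
  -- topology on `Π^temp_{X_K}`, pulled back along the continuous injection into the profinite `Π_{X_K}`
  haveI : T2Space X.PiHat := X.isProfiniteCompletion_toHat.t2Space
  haveI : TotallyDisconnectedSpace X.PiHat := X.isProfiniteCompletion_toHat.totallyDisconnectedSpace
  haveI : T2Space X.PiTemp := T2Space.of_injective_continuous X.toHat_injective X.toHat.continuous
  haveI : TotallyDisconnectedSpace X.PiTemp :=
    ⟨fun s _ hs => Set.subsingleton_of_image X.toHat_injective s
      ((hs.image _ X.toHat.continuous.continuousOn).subsingleton)⟩
  haveI : SecondCountableTopology X.PiTemp := d.secondCountableTopology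
  -- `Δ^temp = Ker(aug)` is closed (`G_{ℚ_p}` is Hausdorff), hence compact
  have hΔclosed : IsClosed (X.DeltaTemp : Set X.PiTemp) := X.isClosed_deltaTemp
  haveI : CompactSpace X.DeltaTemp := isCompact_iff_compactSpace.mp hΔclosed.isCompact
  haveI : SecondCountableTopology X.DeltaTemp := TopologicalSpace.Subtype.secondCountableTopology _
  -- `Δ^temp` is infinite: a finite Hausdorff group is discrete, and a slim group with `{1}` open is trivial,
  -- whereas `Δ^temp` contains a non-commuting pair
  haveI : Infinite X.DeltaTemp := by
    rw [← not_finite_iff_infinite]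
    intro hfin
    have h1 : IsOpen (((⊥ : Subgroup X.DeltaTemp) : Set X.DeltaTemp)) := by
      have hc : IsClosed (({(1 : X.DeltaTemp)} : Set X.DeltaTemp)ᶜ) := (Set.toFinite _).isClosed
      have ho := hc.isOpen_compl
      rwa [compl_compl, ← Subgroup.coe_bot] at ho
    have hbot := hslimΔ.centralizer_eq_bot ⊥ h1
    have htop : Subgroup.centralizer (((⊥ : Subgroup X.DeltaTemp) : Set X.DeltaTemp)) = ⊤ := by
      rw [Subgroup.centralizer_eq_top_iff_subset, Subgroup.coe_bot, Set.singleton_subset_iff]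
      exact Subgroup.one_mem _
    obtain ⟨g, hg, h, hh, hne⟩ := hnc
    have hg1 : (⟨g, hg⟩ : X.DeltaTemp) ∈ (⊥ : Subgroup X.DeltaTemp) := by
      rw [← hbot, htop]; exact Subgroup.mem_top _
    have hg1' : g = 1 := congrArg Subtype.val (Subgroup.mem_bot.mp hg1)
    exact hne (by rw [hg1', one_mul, mul_one])
  -- a level family on `Δ^temp` (every infinite first-countable profinite group carries one)
  obtain ⟨L₀⟩ := ProfiniteSemiGraph.LevelFamily.nonempty_of_infinite (↥X.DeltaTemp)
  -- the special-fibre data: `𝒢^c := B(Δ^temp)`, chart `π₁^temp = Δ^temp`, admissible quotient the identity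
  let D := X.toTemperedArithmeticGroup d
  have hδ : D.delta = X.DeltaTemp := X.toTemperedArithmeticGroup_delta d
  let adm₀ : D.delta →ₜ* X.DeltaTemp :=
    { toMonoidHom := Subgroup.inclusion hδ.le
      continuous_toFun := continuous_inclusion hδ.le }
  let S : SpecialFibreData D :=
    { Gc := OneVertex.graph X.DeltaTemp
      hyp := OneVertex.thm37Hypotheses L₀ hslimΔ
      chart := OneVertex.chart L₀
      admissible := adm₀
      admissible_surjective := fun y => ⟨⟨y.1, hδ.ge y.2⟩, rfl⟩ }
  refine ⟨X, hK, haug, hcpt, hnc, ⟨x₀, hx₀⟩, d, S, S.hyp.toProp36Hypotheses, ?_,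
    fun Sigma SigmaHat hsub hne hprime hp TpH HatH hle cuspMeetsH => ⟨?_, ?_, ?_, ?_, ?_, ?_⟩⟩
  · exact (MonoidHom.ker_eq_bot_iff _).mpr (Subgroup.inclusion_injective hδ.le)
  · exact graph_prop21_ofSpecialFibre_of_compactSpace X d S _ Sigma SigmaHat hsub hne hprime hp TpH HatH hle
      cuspMeetsH
  · exact graph_temperedNormallyTerminal_ofSpecialFibre_of_compactSpace X d S _ Sigma SigmaHat hsub hne hprime
      hp TpH HatH hle cuspMeetsH
  · exact prop24i_ofSpecialFibre_of_compactSpace X d S _ Sigma SigmaHat hsub hne hprime hp TpH HatH hle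
      cuspMeetsH
  · exact prop24ii_ofSpecialFibre_of_compactSpace X d S _ Sigma SigmaHat hsub hne hprime hp TpH HatH hle
      cuspMeetsH
  · exact prop24iii_ofSpecialFibre_of_compactSpace X d S _ Sigma SigmaHat hsub hne hprime hp TpH HatH hle
      cuspMeetsH
  · exact cor25_ofSpecialFibre_of_compactSpace X d S _ Sigma SigmaHat hsub hne hprime hp TpH HatH hle
      cuspMeetsH

end StableCurveTemperedData

end Literature.IUT.HodgeTheaters

end
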